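import Summits.KontsevichZagierPeriods.KontsevichZagierPeriods.Theorems.TerasomaMultiplicationMultiplicationAccessibleCornerGraphSpellingGen
import Summits.KontsevichZagierPeriods.KontsevichZagierPeriods.Theorems.TerasomaMultiplicationMultiplicationAccessibleCornerVGen

/-!
# `MultiplicationAccessible` (stmt-KontsevichZagierPeriods-12305), line `shifted-family-prime-sieve`:
the general-`p` corner Stokes graph package, III — the two representations and the bound

Dimension `p = n + 2`. With
`G t = (Σ_j (∏_{i<j} t_i)/ζ^j)/p · ∏_k t_k^(x+k/p−1)(1 − t_k)^(s−1)` (`ζ = (∏ t)^(1/p)`, `x ≥ 2`,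
`s ≥ 3`) the cube representation `[(0,1)^p, G]` and the chart representation `[U, G(T u)·y^(n+1)]`
(`U` the corner blow-up chart domain, `t_k = T u k = 1 − yΘ_k`) exist — semialgebraic integrands
(rational powers of positive polynomials, `CornerGraphGen.graph_apply`, composed with the polynomial
chart `T`), bounded on domains of finite volume (`CornerVGen.isSemialgebraic_U`,
`CornerVGen.U_subset_Icc` from the landed `v`-move) — and the graph density obeys
`|G(T u)y^(n+1)| ≤ p^(ps−1)(1 − Z u)^(ps−1)` on `U` (division spelling
`G(T u)y^(n+1) = (1/p)y^(ps−1)K·ΣM/t` with `K, M_k/t_k ≤ 1`, and AM–GM `Z ≤ 1 − y/p`):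
`cornerGraphRepsGen`, registered sub-goal (dimension-`p` version of `cornerGraphReps`), the inputs of
the general `v`-move and chart move of the corner Stokes.
References: Kontsevich–Zagier 2001 §1.1–1.2; Bochnak–Coste–Roy 1998 Prop. 2.2.6.
-/

noncomputable section

open MeasureTheory Set Real
open scoped BigOperators
open Literature.NumberTheory.Transcendental
open Literature.NumberTheory.Transcendental.KZ
open Literature.ModelTheory.ExponentialFields (IsSemialgebraic)

namespace Summit.KontsevichZagierPeriods.TerasomaMultiplication.MultiplicationAccessible

namespace CornerGraphGen

/-- A product `t_j^(x−1) ∏_i t_{j+i+1}^(x+(i+1)/p−1)` of real powers with non-negative exponents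
(`x ≥ 1`) of numbers in `[0,1]` lies in `[0,1]`. [folklore] -/
theorem summand_mem {n : ℕ} {x : ℝ} (hx : 1 ≤ x) {t : Fin (n + 2) → ℝ} (h0 : ∀ k, 0 ≤ t k)
    (h1 : ∀ k, t k ≤ 1) (j : Fin (n + 2)) :
    0 ≤ t j ^ (x - 1) * ∏ i : Fin (n + 1), t (j + i.succ) ^ (x + (((i:ℕ):ℝ) + 1) / ((n:ℝ) + 2) - 1) ∧
      t j ^ (x - 1) * ∏ i : Fin (n + 1), t (j + i.succ) ^ (x + (((i:ℕ):ℝ) + 1) / ((n:ℝ) + 2) - 1)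
        ≤ 1 := by
  have he : ∀ i : Fin (n + 1), 0 ≤ x + (((i:ℕ):ℝ) + 1) / ((n:ℝ) + 2) - 1 := fun i => by
    have : 0 ≤ (((i:ℕ):ℝ) + 1) / ((n:ℝ) + 2) := by positivity
    linarith
  refine ⟨mul_nonneg (rpow_nonneg (h0 j) _) (Finset.prod_nonneg fun i _ => rpow_nonneg (h0 _) _),
    ?_⟩
  exact mul_le_one₀ (rpow_le_one (h0 j) (h1 j) (by linarith))
    (Finset.prod_nonneg fun i _ => rpow_nonneg (h0 _) _)
    (Finset.prod_le_one (fun i _ => rpow_nonneg (h0 _) _) fun i _ => rpow_le_one (h0 _) (h1 _) (he i))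

/-- For `t ∈ (0,1]^p` and `x, s ≥ 1` the rotation-averaged integrand lies in `[0,1]`:
`G = (1/p)(Σ_j A_j)·∏(1 − t_k)^(s−1)` with every `A_j ∈ [0,1]` and `∏(1 − t_k)^(s−1) ∈ [0,1]`.
[cite: KontsevichZagier2001, §1.2] -/
theorem graph_mem {n : ℕ} {x s : ℚ} (hx : 1 ≤ x) (hs : 1 ≤ s) {G : (Fin (n + 2) → ℝ) → ℝ}
    (hG : ∀ t : Fin (n + 2) → ℝ, G t = (∑ j : Fin (n + 2), (∏ i ∈ Finset.univ.filter (fun i : Fin (n + 2) => i < j), t i) /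
        ((∏ k, t k) ^ (1 / ((n:ℝ) + 2))) ^ (j:ℕ)) / ((n:ℝ) + 2) *
      ∏ k : Fin (n + 2), (t k) ^ ((x:ℝ) + ((k:ℕ):ℝ) / ((n:ℝ) + 2) - 1) * (1 - t k) ^ ((s:ℝ) - 1))
    {t : Fin (n + 2) → ℝ} (h0 : ∀ k, 0 < t k) (h1 : ∀ k, t k ≤ 1) : 0 ≤ G t ∧ G t ≤ 1 := by
  have hxR : (1:ℝ) ≤ x := by exact_mod_cast hx
  have hsR : (1:ℝ) ≤ s := by exact_mod_cast hs
  have hp : (0:ℝ) < (n:ℝ) + 2 := by positivity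
  rw [graph_apply x s hG h0]
  set A := ∑ j : Fin (n + 2), t j ^ ((x:ℝ) - 1) *
    ∏ i : Fin (n + 1), t (j + i.succ) ^ ((x:ℝ) + (((i:ℕ):ℝ) + 1) / ((n:ℝ) + 2) - 1) with hA
  have hAj := fun j => summand_mem hxR (fun k => (h0 k).le) h1 j
  have hA0 : 0 ≤ A := Finset.sum_nonneg fun j _ => (hAj j).1
  have hA1 : A ≤ (n:ℝ) + 2 := by
    calc A ≤ ∑ _j : Fin (n + 2), (1:ℝ) := Finset.sum_le_sum fun j _ => (hAj j).2
      _ = (n:ℝ) + 2 := by simp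
  have hB0 : 0 ≤ ∏ k, (1 - t k) ^ ((s:ℝ) - 1) :=
    Finset.prod_nonneg fun k _ => rpow_nonneg (by linarith [h1 k]) _
  have hB1 : ∏ k, (1 - t k) ^ ((s:ℝ) - 1) ≤ 1 :=
    Finset.prod_le_one (fun k _ => rpow_nonneg (by linarith [h1 k]) _) fun k _ =>
      rpow_le_one (by linarith [h1 k]) (by linarith [h0 k]) (by linarith)
  refine ⟨mul_nonneg (mul_nonneg (by positivity) hA0) hB0, ?_⟩
  calc 1 / ((n:ℝ) + 2) * A * ∏ k, (1 - t k) ^ ((s:ℝ) - 1)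
      ≤ 1 / ((n:ℝ) + 2) * ((n:ℝ) + 2) * 1 :=
        mul_le_mul (mul_le_mul_of_nonneg_left hA1 (by positivity)) hB1 hB0 (by positivity)
    _ = 1 := by field_simp

/-- On the open cube `|G t| ≤ 1` (`x, s ≥ 1`). [cite: KontsevichZagier2001, §1.2] -/
theorem abs_graph_le_one {n : ℕ} {x s : ℚ} (hx : 1 ≤ x) (hs : 1 ≤ s) {G : (Fin (n + 2) → ℝ) → ℝ}
    (hG : ∀ t : Fin (n + 2) → ℝ, G t = (∑ j : Fin (n + 2), (∏ i ∈ Finset.univ.filter (fun i : Fin (n + 2) => i < j), t i) /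
        ((∏ k, t k) ^ (1 / ((n:ℝ) + 2))) ^ (j:ℕ)) / ((n:ℝ) + 2) *
      ∏ k : Fin (n + 2), (t k) ^ ((x:ℝ) + ((k:ℕ):ℝ) / ((n:ℝ) + 2) - 1) * (1 - t k) ^ ((s:ℝ) - 1))
    {t : Fin (n + 2) → ℝ} (ht : ∀ k, t k ∈ Set.Ioo (0:ℝ) 1) : |G t| ≤ 1 := by
  obtain ⟨h0, h1⟩ := graph_mem hx hs hG (fun k => (ht k).1) fun k => (ht k).2.le
  rw [abs_of_nonneg h0]
  exact h1

/-- `G` is `ℚ`-semialgebraic on the open cube: there it is a polynomial in rational powers of the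
positive coordinates `t_k` and `1 − t_k` (division-free form `graph_apply`).
[cite: BochnakCosteRoy1998, Prop. 2.2.6] -/
theorem isSemialgebraicFunOn_graph {n : ℕ} (x s : ℚ) {G : (Fin (n + 2) → ℝ) → ℝ}
    (hG : ∀ t : Fin (n + 2) → ℝ, G t = (∑ j : Fin (n + 2), (∏ i ∈ Finset.univ.filter (fun i : Fin (n + 2) => i < j), t i) /
        ((∏ k, t k) ^ (1 / ((n:ℝ) + 2))) ^ (j:ℕ)) / ((n:ℝ) + 2) *
      ∏ k : Fin (n + 2), (t k) ^ ((x:ℝ) + ((k:ℕ):ℝ) / ((n:ℝ) + 2) - 1) * (1 - t k) ^ ((s:ℝ) - 1)) :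
    IsSemialgebraicFunOn ℚ {t : Fin (n + 2) → ℝ | ∀ k, t k ∈ Set.Ioo (0:ℝ) 1} G := by
  set B : Set (Fin (n + 2) → ℝ) := {t : Fin (n + 2) → ℝ | ∀ k, t k ∈ Set.Ioo (0:ℝ) 1} with hB_def
  have hB : IsSemialgebraic ℚ B := KZ.isSemialgebraic_box (n + 2)
  have hc : ∀ i : Fin (n + 2), IsSemialgebraicFunOn ℚ B (fun t => t i) := fun i =>
    isSemialgebraicFunOn_apply hB i
  have h1 : IsSemialgebraicFunOn ℚ B (fun _ => (1:ℝ)) := by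
    simpa using isSemialgebraicFunOn_ratCast hB 1
  have hp : ∀ (i : Fin (n + 2)) (q : ℚ), IsSemialgebraicFunOn ℚ B (fun t => t i ^ ((q:ℚ):ℝ)) :=
    fun i q => (hc i).rpow_ratCast hB (fun t ht => (ht i).1) q
  have hq : ∀ (i : Fin (n + 2)) (q : ℚ), IsSemialgebraicFunOn ℚ B
      (fun t => (1 - t i) ^ ((q:ℚ):ℝ)) := fun i q =>
    (h1.fun_sub (hc i)).rpow_ratCast hB (fun t ht => by linarith [(ht i).2]) q
  have h3 : IsSemialgebraicFunOn ℚ B (fun _ => (((1 / ((n:ℚ) + 2) : ℚ)) : ℝ)) :=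
    isSemialgebraicFunOn_ratCast hB _
  have hF := (h3.fun_mul (IsSemialgebraicFunOn.fun_finsetSum Finset.univ hB fun j _ =>
      (hp j (x - 1)).fun_mul (IsSemialgebraicFunOn.fun_finsetProd Finset.univ hB fun i _ =>
        hp (j + Fin.succ i) (x + (((i:ℕ):ℚ) + 1) / ((n:ℚ) + 2) - 1)))).fun_mul
    (IsSemialgebraicFunOn.fun_finsetProd Finset.univ hB fun k _ => hq k (s - 1))
  refine hF.congr fun t ht => ?_
  rw [graph_apply x s hG fun k => (ht k).1]
  push_cast
  rfl

/-- The blow-up chart `u ↦ T u = (1 − yΘ_k)_k` is a `ℚ`-semialgebraic map on every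
`ℚ`-semialgebraic set (its coordinates are polynomials). [cite: BochnakCosteRoy1998, §2.2] -/
theorem isSemialgebraicMapOn_T {n : ℕ} {Θ T : (Fin (n + 2) → ℝ) → Fin (n + 2) → ℝ}
    (hΘ0 : ∀ u, Θ u 0 = 1 - ∑ i : Fin (n + 1), u (Fin.castSucc i))
    (hΘs : ∀ u (i : Fin (n + 1)), Θ u i.succ = u (Fin.castSucc i))
    (hT : ∀ u k, T u k = 1 - u (Fin.last (n + 1)) * Θ u k) {σ : Set (Fin (n + 2) → ℝ)}
    (hσ : IsSemialgebraic ℚ σ) : IsSemialgebraicMapOn ℚ σ T := by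
  have hc : ∀ j : Fin (n + 2), IsSemialgebraicFunOn ℚ σ (fun u => u j) := fun j =>
    isSemialgebraicFunOn_apply hσ j
  have h1 : IsSemialgebraicFunOn ℚ σ (fun _ => (1:ℝ)) := by
    simpa using isSemialgebraicFunOn_ratCast hσ 1
  refine IsSemialgebraicMapOn.of_forall hσ fun k => ?_
  refine Fin.cases ?_ (fun i => ?_) k
  · exact (h1.fun_sub ((hc (Fin.last (n + 1))).fun_mul (h1.fun_sub
      (IsSemialgebraicFunOn.fun_finsetSum Finset.univ hσ fun i _ => hc (Fin.castSucc i))))).congr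
      fun u _ => by simp only [hT, hΘ0]
  · exact (h1.fun_sub ((hc (Fin.last (n + 1))).fun_mul (hc (Fin.castSucc i)))).congr
      fun u _ => by simp only [hT, hΘs]

/-- **AM–GM on the chart domain**: `Z u = (∏ t_k)^(1/p) = ∏ t_k^(1/p) ≤ (Σ t_k)/p = 1 − y/p`
(`Σ_k t_k = p − y·ΣΘ = p − y`). [folklore] -/
theorem Z_le {n : ℕ} {Θ T : (Fin (n + 2) → ℝ) → Fin (n + 2) → ℝ} {Z : (Fin (n + 2) → ℝ) → ℝ}
    (hΘ0 : ∀ u, Θ u 0 = 1 - ∑ i : Fin (n + 1), u (Fin.castSucc i))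
    (hΘs : ∀ u (i : Fin (n + 1)), Θ u i.succ = u (Fin.castSucc i))
    (hT : ∀ u k, T u k = 1 - u (Fin.last (n + 1)) * Θ u k)
    (hZ : ∀ u, Z u = (∏ k, T u k) ^ (1 / ((n:ℝ) + 2))) {u : Fin (n + 2) → ℝ}
    (hu : u ∈ {u : Fin (n + 2) → ℝ | (∀ i : Fin (n + 1), 0 < u (Fin.castSucc i)) ∧ ∑ i : Fin (n + 1), u (Fin.castSucc i) < 1 ∧ 0 < u (Fin.last (n + 1)) ∧ u (Fin.last (n + 1)) * (1 - ∑ i : Fin (n + 1), u (Fin.castSucc i)) < 1 ∧ ∀ i : Fin (n + 1), u (Fin.last (n + 1)) * u (Fin.castSucc i) < 1}) :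
    Z u ≤ 1 - u (Fin.last (n + 1)) / ((n:ℝ) + 2) := by
  have ht := fun k => (T_mem hΘ0 hΘs hT hu k).2
  have hp : (0:ℝ) < (n:ℝ) + 2 := by positivity
  have hw : ∑ _k : Fin (n + 2), (1 / ((n:ℝ) + 2)) = 1 := by
    rw [Finset.sum_const, Finset.card_univ, Fintype.card_fin, nsmul_eq_mul]
    push_cast
    field_simp
  have hamgm := Real.geom_mean_le_arith_mean_weighted Finset.univ (fun _ => 1 / ((n:ℝ) + 2)) (T u)
    (fun _ _ => by positivity) hw fun k _ => (ht k).1.le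
  have hsumT : ∑ k, T u k = (n:ℝ) + 2 - u (Fin.last (n + 1)) := by
    simp only [hT]
    rw [Finset.sum_sub_distrib, Finset.sum_const, Finset.card_univ, Fintype.card_fin,
      ← Finset.mul_sum, sum_theta hΘ0 hΘs u, nsmul_eq_mul]
    push_cast
    ring
  rw [hZ, ← Real.finsetProd_rpow Finset.univ _ (fun k _ => (ht k).1.le)]
  calc ∏ k, T u k ^ (1 / ((n:ℝ) + 2)) ≤ ∑ k, 1 / ((n:ℝ) + 2) * T u k := hamgm
    _ = 1 - u (Fin.last (n + 1)) / ((n:ℝ) + 2) := by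
      rw [← Finset.mul_sum, hsumT]
      field_simp

/-- **The bound on the chart domain**: for `x, s ≥ 1`,
`0 ≤ (1/p)·y^(ps−1)·K·Σ_k M_k/t_k ≤ p^(ps−1)(1 − Z)^(ps−1)` on `U` (`M_k/t_k, K ∈ [0,1]`, and
`y ≤ p(1 − Z)` by AM–GM). [cite: KontsevichZagier2001, §1.2] -/
theorem chart_bound {n : ℕ} {x s : ℚ} (hx : 1 ≤ x) (hs : 1 ≤ s)
    {Θ T : (Fin (n + 2) → ℝ) → Fin (n + 2) → ℝ} {Z K : (Fin (n + 2) → ℝ) → ℝ}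
    {M : (Fin (n + 2) → ℝ) → Fin (n + 2) → ℝ}
    (hΘ0 : ∀ u, Θ u 0 = 1 - ∑ i : Fin (n + 1), u (Fin.castSucc i))
    (hΘs : ∀ u (i : Fin (n + 1)), Θ u i.succ = u (Fin.castSucc i))
    (hT : ∀ u k, T u k = 1 - u (Fin.last (n + 1)) * Θ u k)
    (hZ : ∀ u, Z u = (∏ k, T u k) ^ (1 / ((n:ℝ) + 2)))
    (hK : ∀ u, K u = (∏ k, Θ u k) ^ ((s:ℝ) - 1))
    (hM : ∀ u k, M u k = (T u k) ^ (x:ℝ) * ∏ j : Fin (n + 1), (T u (k + j.succ)) ^ ((x:ℝ) + (((j:ℕ):ℝ) + 1) / ((n:ℝ) + 2) - 1))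
    {u : Fin (n + 2) → ℝ}
    (hu : u ∈ {u : Fin (n + 2) → ℝ | (∀ i : Fin (n + 1), 0 < u (Fin.castSucc i)) ∧ ∑ i : Fin (n + 1), u (Fin.castSucc i) < 1 ∧ 0 < u (Fin.last (n + 1)) ∧ u (Fin.last (n + 1)) * (1 - ∑ i : Fin (n + 1), u (Fin.castSucc i)) < 1 ∧ ∀ i : Fin (n + 1), u (Fin.last (n + 1)) * u (Fin.castSucc i) < 1}) :
    0 ≤ 1 / ((n:ℝ) + 2) * (u (Fin.last (n + 1))) ^ (((n:ℝ) + 2) * (s:ℝ) - 1) * K u *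
        ∑ k, M u k / T u k ∧
      1 / ((n:ℝ) + 2) * (u (Fin.last (n + 1))) ^ (((n:ℝ) + 2) * (s:ℝ) - 1) * K u *
          ∑ k, M u k / T u k ≤
        ((n:ℝ) + 2) ^ (((n:ℝ) + 2) * (s:ℝ) - 1) * (1 - Z u) ^ (((n:ℝ) + 2) * (s:ℝ) - 1) := by
  have hxR : (1:ℝ) ≤ x := by exact_mod_cast hx
  have hsR : (1:ℝ) ≤ s := by exact_mod_cast hs
  have hmem := T_mem hΘ0 hΘs hT hu
  have hy : 0 < u (Fin.last (n + 1)) := hu.2.2.1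
  have hp : (0:ℝ) < (n:ℝ) + 2 := by positivity
  have hps : (0:ℝ) ≤ ((n:ℝ) + 2) * (s:ℝ) - 1 := by
    have hn : (0:ℝ) ≤ n := n.cast_nonneg
    nlinarith
  -- `M_k / t_k ∈ [0,1]`, `Σ_k M_k/t_k ≤ p`
  have hA : ∀ k, 0 ≤ M u k / T u k ∧ M u k / T u k ≤ 1 := fun k => by
    rw [M_div_T x hM (hmem k).2.1.ne']
    exact summand_mem hxR (fun j => (hmem j).2.1.le) (fun j => (hmem j).2.2.le) k
  have hS0 : 0 ≤ ∑ k, M u k / T u k := Finset.sum_nonneg fun k _ => (hA k).1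
  have hS1 : ∑ k, M u k / T u k ≤ (n:ℝ) + 2 := by
    calc ∑ k, M u k / T u k ≤ ∑ _k : Fin (n + 2), (1:ℝ) := Finset.sum_le_sum fun k _ => (hA k).2
      _ = (n:ℝ) + 2 := by simp
  -- `K ∈ [0,1]`
  have hΘ1 : ∀ k, Θ u k ≤ 1 := fun k =>
    (Finset.single_le_sum (fun j _ => (hmem j).1.1.le) (Finset.mem_univ k)).trans
      (sum_theta hΘ0 hΘs u).le
  have hPΘ0 : 0 ≤ ∏ k, Θ u k := Finset.prod_nonneg fun k _ => (hmem k).1.1.le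
  have hPΘ1 : ∏ k, Θ u k ≤ 1 := Finset.prod_le_one (fun k _ => (hmem k).1.1.le) fun k _ => hΘ1 k
  have hK0 : 0 ≤ K u := by rw [hK]; exact rpow_nonneg hPΘ0 _
  have hK1 : K u ≤ 1 := by rw [hK]; exact rpow_le_one hPΘ0 hPΘ1 (by linarith)
  -- `y ≤ p (1 - Z)` (AM–GM), so `y^(ps-1) ≤ p^(ps-1) (1 - Z)^(ps-1)`
  have hyZ : u (Fin.last (n + 1)) ≤ ((n:ℝ) + 2) * (1 - Z u) := by
    have h := Z_le hΘ0 hΘs hT hZ hu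
    rw [le_sub_comm, div_le_iff₀ hp] at h
    linarith
  have h1Z : 0 ≤ 1 - Z u := (pos_of_mul_pos_right (hy.trans_le hyZ) hp.le).le
  have hypow : u (Fin.last (n + 1)) ^ (((n:ℝ) + 2) * (s:ℝ) - 1) ≤
      ((n:ℝ) + 2) ^ (((n:ℝ) + 2) * (s:ℝ) - 1) * (1 - Z u) ^ (((n:ℝ) + 2) * (s:ℝ) - 1) := by
    rw [← mul_rpow hp.le h1Z]
    exact rpow_le_rpow hy.le hyZ hps
  have hy0 : 0 ≤ u (Fin.last (n + 1)) ^ (((n:ℝ) + 2) * (s:ℝ) - 1) := rpow_nonneg hy.le _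
  refine ⟨mul_nonneg (mul_nonneg (mul_nonneg (by positivity) hy0) hK0) hS0, ?_⟩
  set Y := u (Fin.last (n + 1)) ^ (((n:ℝ) + 2) * (s:ℝ) - 1)
  set Bd := ((n:ℝ) + 2) ^ (((n:ℝ) + 2) * (s:ℝ) - 1) * (1 - Z u) ^ (((n:ℝ) + 2) * (s:ℝ) - 1)
  have hBd : 0 ≤ Bd := hy0.trans hypow
  have step : Y * K u * ∑ k, M u k / T u k ≤ Bd * 1 * ((n:ℝ) + 2) :=
    mul_le_mul (mul_le_mul hypow hK1 hK0 hBd) hS1 hS0 (by rw [mul_one]; exact hBd)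
  have key : 1 / ((n:ℝ) + 2) * (Y * K u * ∑ k, M u k / T u k) ≤
      1 / ((n:ℝ) + 2) * (Bd * 1 * ((n:ℝ) + 2)) := mul_le_mul_of_nonneg_left step (by positivity)
  have e1 : 1 / ((n:ℝ) + 2) * Y * K u * ∑ k, M u k / T u k =
      1 / ((n:ℝ) + 2) * (Y * K u * ∑ k, M u k / T u k) := by ring
  have e2 : 1 / ((n:ℝ) + 2) * (Bd * 1 * ((n:ℝ) + 2)) = Bd := by
    field_simp
  rw [e1]
  exact key.trans_eq e2

end CornerGraphGen

/-- **The two representations and the bound, dimension `p = n + 2`** (registered sub-goal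
`cornerGraphRepsGen`): for `x ≥ 2`, `s ≥ 3` the cube representation `[(0,1)^p, G]` and the chart
representation `[U, G(T u)·y^(n+1)]` exist (semialgebraic integrands — rational powers of positive
polynomials, composed with the polynomial chart `T` — bounded on domains of finite volume), and
`|G(T u)y^(n+1)| ≤ p^(ps−1)(1 − Z u)^(ps−1)` on `U`. [cite: KontsevichZagier2001, §1.1–1.2] -/
theorem cornerGraphRepsGen : ∀ (n : ℕ) (x s : ℚ), 2 ≤ x → 3 ≤ s → ∀ (Θ T : (Fin (n + 2) → ℝ) → Fin (n + 2) → ℝ) (Z S H K : (Fin (n + 2) → ℝ) → ℝ)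
      (M : (Fin (n + 2) → ℝ) → Fin (n + 2) → ℝ) (P : (Fin (n + 3) → ℝ) → ℝ),
    (∀ u, Θ u 0 = 1 - ∑ i : Fin (n + 1), u (Fin.castSucc i)) → (∀ u (i : Fin (n + 1)), Θ u i.succ = u (Fin.castSucc i)) →
    (∀ u k, T u k = 1 - u (Fin.last (n + 1)) * Θ u k) →
    (∀ u, Z u = (∏ k, T u k) ^ (1 / ((n:ℝ) + 2))) →
    (∀ u, S u = ∑ j ∈ Finset.range (n + 2), (-1:ℝ) ^ j * u (Fin.last (n + 1)) ^ j *
      ∑ A ∈ Finset.powersetCard (j + 1) (Finset.univ : Finset (Fin (n + 2))), ∏ k ∈ A, Θ u k) →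
    (∀ u, H u = (∑ j ∈ Finset.range (n + 2), Z u ^ j) / S u) →
    (∀ u, K u = (∏ k, Θ u k) ^ ((s:ℝ) - 1)) →
    (∀ u k, M u k = (T u k) ^ (x:ℝ) * ∏ j : Fin (n + 1), (T u (k + j.succ)) ^ ((x:ℝ) + (((j:ℕ):ℝ) + 1) / ((n:ℝ) + 2) - 1)) →
    (∀ w, P w = (w (Fin.last (n + 2))) ^ (((n:ℝ) + 2) * (x:ℝ) - 1) *
      (1 - w (Fin.last (n + 2)) * Z (Fin.init w)) ^ (((n:ℝ) + 2) * (s:ℝ) - 1) * H (Fin.init w) ^ (((n:ℝ) + 2) * (s:ℝ)) * K (Fin.init w)) →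
    ∀ (G : (Fin (n + 2) → ℝ) → ℝ), (∀ t : Fin (n + 2) → ℝ, G t = (∑ j : Fin (n + 2), (∏ i ∈ Finset.univ.filter (fun i : Fin (n + 2) => i < j), t i) /
        ((∏ k, t k) ^ (1 / ((n:ℝ) + 2))) ^ (j:ℕ)) / ((n:ℝ) + 2) *
      ∏ k : Fin (n + 2), (t k) ^ ((x:ℝ) + ((k:ℕ):ℝ) / ((n:ℝ) + 2) - 1) * (1 - t k) ^ ((s:ℝ) - 1)) →
    (∃ r₀ : KZ.IntegralRep (n + 2), r₀.domain = {t : Fin (n + 2) → ℝ | ∀ k, t k ∈ Set.Ioo (0:ℝ) 1} ∧ r₀.integrand = G) ∧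
    (∃ rU : KZ.IntegralRep (n + 2), rU.domain = {u : Fin (n + 2) → ℝ | (∀ i : Fin (n + 1), 0 < u (Fin.castSucc i)) ∧ ∑ i : Fin (n + 1), u (Fin.castSucc i) < 1 ∧ 0 < u (Fin.last (n + 1)) ∧ u (Fin.last (n + 1)) * (1 - ∑ i : Fin (n + 1), u (Fin.castSucc i)) < 1 ∧ ∀ i : Fin (n + 1), u (Fin.last (n + 1)) * u (Fin.castSucc i) < 1} ∧
      rU.integrand = fun u => G (T u) * (u (Fin.last (n + 1))) ^ (n + 1)) ∧
    (∃ C : ℝ, ∀ u ∈ {u : Fin (n + 2) → ℝ | (∀ i : Fin (n + 1), 0 < u (Fin.castSucc i)) ∧ ∑ i : Fin (n + 1), u (Fin.castSucc i) < 1 ∧ 0 < u (Fin.last (n + 1)) ∧ u (Fin.last (n + 1)) * (1 - ∑ i : Fin (n + 1), u (Fin.castSucc i)) < 1 ∧ ∀ i : Fin (n + 1), u (Fin.last (n + 1)) * u (Fin.castSucc i) < 1},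
      |G (T u) * (u (Fin.last (n + 1))) ^ (n + 1)| ≤ C * (1 - Z u) ^ (((n:ℝ) + 2) * (s:ℝ) - 1)) := by
  intro n x s hx hs Θ T Z S H K M P hΘ0 hΘs hT hZ hS hH hK hM hP G hG
  have hx1 : (1:ℚ) ≤ x := by linarith
  have hs1 : (1:ℚ) ≤ s := by linarith
  have hps : (0:ℝ) ≤ ((n:ℝ) + 2) * (s:ℝ) - 1 := by
    have hsR : (1:ℝ) ≤ s := by exact_mod_cast hs1
    have hn : (0:ℝ) ≤ n := n.cast_nonneg
    nlinarith
  -- the cube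
  set B : Set (Fin (n + 2) → ℝ) := {t : Fin (n + 2) → ℝ | ∀ k, t k ∈ Set.Ioo (0:ℝ) 1} with hBdef
  have hBsa : IsSemialgebraic ℚ B := KZ.isSemialgebraic_box (n + 2)
  have hBmeas : MeasurableSet B :=
    Literature.ModelTheory.ExponentialFields.IsSemialgebraic.measurableSet_holds hBsa
  have hBvol : volume B < ⊤ :=
    lt_of_le_of_lt (measure_mono fun t (ht : t ∈ B) =>
      (⟨fun i => (ht i).1.le, fun i => (ht i).2.le⟩ : t ∈ Icc (0 : Fin (n + 2) → ℝ) 1))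
      (measure_Icc_lt_top (a := (0 : Fin (n + 2) → ℝ)) (b := 1))
  have hGsa : IsSemialgebraicFunOn ℚ B G := CornerGraphGen.isSemialgebraicFunOn_graph x s hG
  have hGint : IntegrableOn G B :=
    ⟨aestronglyMeasurable_of_isSemialgebraicFunOn hGsa hBmeas,
      HasFiniteIntegral.restrict_of_bounded (C := 1) hBvol ((ae_restrict_mem hBmeas).mono
        fun t ht => by
          rw [Real.norm_eq_abs]
          exact CornerGraphGen.abs_graph_le_one hx1 hs1 hG ht)⟩
  -- the chart domain
  set U : Set (Fin (n + 2) → ℝ) := {u : Fin (n + 2) → ℝ | (∀ i : Fin (n + 1), 0 < u (Fin.castSucc i)) ∧ ∑ i : Fin (n + 1), u (Fin.castSucc i) < 1 ∧ 0 < u (Fin.last (n + 1)) ∧ u (Fin.last (n + 1)) * (1 - ∑ i : Fin (n + 1), u (Fin.castSucc i)) < 1 ∧ ∀ i : Fin (n + 1), u (Fin.last (n + 1)) * u (Fin.castSucc i) < 1} with hUdef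
  have hUsa : IsSemialgebraic ℚ U := CornerVGen.isSemialgebraic_U n
  have hUmeas : MeasurableSet U :=
    Literature.ModelTheory.ExponentialFields.IsSemialgebraic.measurableSet_holds hUsa
  have hUvol : volume U < ⊤ :=
    lt_of_le_of_lt (measure_mono fun u (hu : u ∈ U) => CornerVGen.U_subset_Icc hu)
      (measure_Icc_lt_top (a := (0 : Fin (n + 2) → ℝ)) (b := fun _ => (n:ℝ) + 2))
  have hΦ : IsSemialgebraicMapOn ℚ U T := CornerGraphGen.isSemialgebraicMapOn_T hΘ0 hΘs hT hUsa
  have hmaps : MapsTo T U B := fun u hu k => (CornerGraphGen.T_mem hΘ0 hΘs hT hu k).2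
  have hGDsa : IsSemialgebraicFunOn ℚ U (fun u => G (T u) * (u (Fin.last (n + 1))) ^ (n + 1)) :=
    ((IsSemialgebraicFunOn.comp_isSemialgebraicMapOn_holds hGsa hΦ hmaps).congr
      fun u _ => rfl).fun_mul ((isSemialgebraicFunOn_apply hUsa (Fin.last (n + 1))).fun_pow (n + 1))
  have hbound : ∀ u ∈ U, |G (T u) * (u (Fin.last (n + 1))) ^ (n + 1)| ≤
      ((n:ℝ) + 2) ^ (((n:ℝ) + 2) * (s:ℝ) - 1) * (1 - Z u) ^ (((n:ℝ) + 2) * (s:ℝ) - 1) := by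
    intro u hu
    obtain ⟨hGD, -, -⟩ :=
      cornerGraphSpellingGen n x s hx hs Θ T Z S H K M P hΘ0 hΘs hT hZ hS hH hK hM hP G hG u hu
    obtain ⟨h0, h1⟩ := CornerGraphGen.chart_bound hx1 hs1 hΘ0 hΘs hT hZ hK hM hu
    rw [hGD, abs_of_nonneg h0]
    exact h1
  have hbound' : ∀ u ∈ U, |G (T u) * (u (Fin.last (n + 1))) ^ (n + 1)| ≤
      ((n:ℝ) + 2) ^ (((n:ℝ) + 2) * (s:ℝ) - 1) := by
    intro u hu
    refine (hbound u hu).trans ?_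
    obtain ⟨-, ⟨hz0, hz1⟩, -, -⟩ := CornerGraphGen.S_pos_H hΘ0 hΘs hT hZ hS hH hu
    have h1 : (1 - Z u) ^ (((n:ℝ) + 2) * (s:ℝ) - 1) ≤ 1 :=
      rpow_le_one (by linarith) (by linarith) hps
    have h3 : 0 ≤ ((n:ℝ) + 2) ^ (((n:ℝ) + 2) * (s:ℝ) - 1) := by positivity
    exact mul_le_of_le_one_right h3 h1
  have hGDint : IntegrableOn (fun u => G (T u) * (u (Fin.last (n + 1))) ^ (n + 1)) U :=
    ⟨aestronglyMeasurable_of_isSemialgebraicFunOn hGDsa hUmeas,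
      HasFiniteIntegral.restrict_of_bounded (C := ((n:ℝ) + 2) ^ (((n:ℝ) + 2) * (s:ℝ) - 1)) hUvol
        ((ae_restrict_mem hUmeas).mono fun u hu => by
          rw [Real.norm_eq_abs]
          exact hbound' u hu)⟩
  exact ⟨⟨⟨B, G, hBsa, hGsa, hGint⟩, rfl, rfl⟩, ⟨⟨U, _, hUsa, hGDsa, hGDint⟩, rfl, rfl⟩,
    ⟨((n:ℝ) + 2) ^ (((n:ℝ) + 2) * (s:ℝ) - 1), hbound⟩⟩

end Summit.KontsevichZagierPeriods.TerasomaMultiplication.MultiplicationAccessible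

end
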